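import Summits.CriticalPhenomena.SAWScalingLimit.Theses.SAWDefectDecoherence
import Summits.CriticalPhenomena.SAWScalingLimit.Theorems.SAWDefectDecoherencePickHalfPlaneDefs
import Summits.CriticalPhenomena.SAWScalingLimit.Theorems.SAWDefectDecoherenceBoundaryClosureRLocalL1Normaliser
import Summits.CriticalPhenomena.SAWScalingLimit.Theorems.SAWDefectDecoherenceBoundaryClosureRGateMassLaws
import Literature.Probability.RandomPlanarGeometry.HexParafermionProofs
import Literature.Probability.LatticeModels.TriangularLatticeProofs
import HarnessLib

/-!
# The upper half of the flat density law from the local sup law (crux `BoundaryClosureR`,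
stmt-CriticalPhenomena-14004, line `pick-half-plane`, stub
`stub_flatDensityUpperOfSup : LocalSupBound → FlatDensityUpper`)

`FlatDensityUpper` asks, for every window `ball y ρ₀` on the gate piece (`im y = im (D.pt 1)`,
`closedBall y ρ₀ ⊆ ball (D.pt 1) ρ`, row function `m`) or on the root's own flat piece
(`im y = im x`, `closedBall y ρ₀ ⊆ ball x r`, row function `mr`), root off `closedBall y (2ρ₀)`,
for ONE `C > 0` with, eventually as `δ → 0+`, `Z(fe) ≤ C · Z(b δ)` for every floor edge
`fe = {(![k,M-1],1), (![k,M],0)}` of the row `M = row δ` with `δ·mid fe ∈ ball y ρ₀`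
(`Z = ‖F_{e δ, x_c, 0}‖`, the arrival mass).  `LocalSupBound` gives `‖F_{5/8}(z)‖ ≤ C_K ‖F_{5/8}(b δ)‖`
at the mid-edges `z` of `Ω_δ` with `δ·mid z` in a compact `K ⊆ carrier ∪ flat pieces` off the root.

The reduction (`flatDensityUpper_core`: one window in a frame `(carrier, c₀, R, row)`;
`flatDensityUpper_of_localSupBound`: the registered statement, the line-local definitions
`LocalSupBound`, `FlatDensityUpper`, `AdmissibleFamily`, `PinnedFlatRoot`, `flatPoints` unfolded
verbatim).  Slack: `closedBall y (ρ₀ + 2ε) ⊆ ball c₀ R` for some `0 < ε ≤ ρ₀/2`, so the compact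
`K := closedBall y (ρ₀ + ε) ∩ {im ≥ im c₀}` lies in `{im ≥ im c₀} ∩ ball c₀ R ⊆ carrier ∪ flat
pieces` (carrier pin) and misses `x`.  For `δ < ε` and `δ·mid fe ∈ ball y ρ₀`, both endpoints of
`fe` have scaled centres in `ball c₀ R` (within `δ/2`), so by the lattice pin the up-face
`v = (![k,M],0)` is in `Λ δ` and the face below is not: `fe ∈ ∂Ω_δ`, whence
`‖F_{5/8}(fe)‖ = Z(fe)`, `‖F_{5/8}(b δ)‖ = Z(b δ)` (winding rigidity at boundary mid-edges).
`δ c_v ∈ carrier ∩ ball c₀ R` gives `im (δ c_v) > im c₀`, so the two upper edges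
`{v, (![k,M],1)}`, `{v, (![k-1,M],1)}` of `Ω_δ` have scaled midpoints in `K` and the sup law bounds
them; the VERTEX RELATION at `v` (Duminil-Copin–Smirnov 2012, Lemma 1, proved in the tree),
`Σ_{3 edges at v} (mid − c_v) F_{5/8} = 0` with half-edge vectors of norms `≥ 1/4` (floor edge,
`−i/(2√3)`) and `≤ 1/2`, gives `Z(fe) ≤ 2(‖F(upper₁)‖ + ‖F(upper₂)‖) ≤ 4 C_K Z(b δ)`.

References: H. Duminil-Copin, S. Smirnov, Ann. of Math. 175 (2012), Lemma 1 and §3.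
-/

noncomputable section

open scoped BigOperators Topology
open Filter Set
open Literature.Probability.LatticeModels Literature.Probability.RandomPlanarGeometry
open Literature.Probability.RandomPlanarGeometry.SAW
open Literature.Probability.Percolation (hexCenter_im)
open Summit.CriticalPhenomena.SAWScalingLimit.Theorems.DecoherenceSynthesis
  (dist_smul_smul norm_hexMidpoint_sub_hexCenter_le)
open Summit.CriticalPhenomena.SAWScalingLimit.Theorems.ObservableToSLE.FloorRatio
  (dist_hexCenter_hexMidpoint_le)
open Summit.CriticalPhenomena.SAWScalingLimit.Theorems.PickHalfPlane.GateMass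
  (floorEdge_mem_boundary_of_pin)
open Summit.CriticalPhenomena.SAWScalingLimit.Theorems.PickHalfPlane.LocalL1
  (norm_observable_eq_norm_zero_spin_of_mem_boundary)

namespace Summit.CriticalPhenomena.SAWScalingLimit.Theorems.PickHalfPlane.FlatDensityUpper

/-! ### 1. Lattice geometry around the up-face over a floor edge -/

/-- `![k, m] - e₀ = ![k - 1, m]`. [folklore] -/
theorem vec_sub_single_zero (k m : ℤ) : (![k, m] : Site 2) - Pi.single 0 1 = ![k - 1, m] := by
  rw [site_two_eq_iff]
  simp

/-- The up-face `(![k,m],0)` is adjacent to the down-face `(![k,m],1)` of its own cell. [folklore] -/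
theorem adj_upFace_right (k m : ℤ) : hexGraph.Adj (upFace k m) (((![k, m] : Site 2)), (1 : Fin 2)) :=
  (hexGraph_adj_iff_of_snd_eq_zero_holds _ _).2 (Or.inl rfl)

/-- The up-face `(![k,m],0)` is adjacent to the down-face `(![k-1,m],1)` west of it. [folklore] -/
theorem adj_upFace_left (k m : ℤ) :
    hexGraph.Adj (upFace k m) (((![k - 1, m] : Site 2)), (1 : Fin 2)) :=
  (hexGraph_adj_iff_of_snd_eq_zero_holds _ _).2 (Or.inr (Or.inl (vec_sub_single_zero k m).symm))

/-- The midpoint of an edge from an up-face `(p, 0)` to a down-face `(q, 1)` of the same row lies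
(weakly) above the centre of the up-face. [folklore] -/
theorem im_hexCenter_le_im_hexMidpoint (p q : Site 2) (h : p 1 = q 1) :
    (hexCenter (p, (0 : Fin 2))).im ≤ (hexMidpoint s((p, (0 : Fin 2)), (q, (1 : Fin 2)))).im := by
  have hle : (hexCenter (p, (0 : Fin 2))).im ≤ (hexCenter (q, (1 : Fin 2))).im := by
    rw [hexCenter_im, hexCenter_im, h]
    refine mul_le_mul_of_nonneg_right ?_ (by positivity)
    simp only [Fin.val_zero, Nat.cast_zero, Fin.val_one, Nat.cast_one]
    norm_num
  rw [hexMidpoint_mk, Complex.div_ofNat_im, Complex.add_im]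
  linarith

/-- The half-edge vector of a floor edge (`−i/(2√3)`) has norm `≥ 1/4`. [folklore] -/
theorem quarter_le_norm_floor_halfEdge (k m : ℤ) :
    1 / 4 ≤ ‖hexMidpoint (floorEdge k m) - hexCenter (upFace k m)‖ := by
  rw [hexMidpoint_floorEdge_sub]
  refine le_trans ?_ (Complex.abs_im_le_norm _)
  have him : ((1 - 2 * triZeta) / 6 : ℂ).im = -(Real.sqrt 3 / 6) := by
    rw [Complex.div_ofNat_im]
    simp [Complex.sub_im, Complex.mul_im, triZeta_im, triZeta_re]
    ring
  rw [him, abs_neg, abs_of_nonneg (by positivity)]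
  have h3 : Real.sqrt 3 * Real.sqrt 3 = 3 := Real.mul_self_sqrt (by norm_num)
  nlinarith [Real.sqrt_nonneg 3]

/-- Scaled centres of the endpoints of an edge are within `δ/2` of its scaled midpoint. [folklore] -/
theorem dist_smul_hexCenter_smul_hexMidpoint_le {δ : ℝ} (hδ : 0 ≤ δ) {z : Sym2 HexVertex}
    (hz : z ∈ hexGraph.edgeSet) {u : HexVertex} (hu : u ∈ z) :
    dist ((δ : ℂ) * hexCenter u) ((δ : ℂ) * hexMidpoint z) ≤ δ / 2 := by
  rw [dist_smul_smul hδ]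
  have := mul_le_mul_of_nonneg_left (dist_hexCenter_hexMidpoint_le hz hu) hδ
  linarith

/-- **The vertex relation at the up-face bounds the floor value.** For a simply connected `Λ` with
boundary root `a` and the up-face `v = (![k,m],0) ∈ Λ`:
`‖F(floorEdge k m)‖ ≤ 2 (‖F({v, (![k,m],1)})‖ + ‖F({v, (![k-1,m],1)})‖)` for `F = F_{a, x_c, 5/8}`
(DCS Lemma 1 at `v`; of the three half-edge vectors, all of length `1/(2√3)`, only `≥ 1/4` for the
floor edge and `≤ 1/2` for the other two are used). [cite: DuminilCopinSmirnov2012, Lemma 1] -/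
theorem norm_floorEdge_le_of_vertexRelation {Λ : Finset HexVertex} (hΛ : hexDomainSimplyConnected Λ)
    {a : Sym2 HexVertex} (ha : a ∈ hexDomainBoundary Λ) {k m : ℤ} (hv : upFace k m ∈ Λ) :
    ‖hexParafermionicObservable Λ a hexCriticalFugacity (5 / 8) (floorEdge k m)‖ ≤
      2 * (‖hexParafermionicObservable Λ a hexCriticalFugacity (5 / 8)
              s(upFace k m, (((![k, m] : Site 2)), (1 : Fin 2)))‖ +
           ‖hexParafermionicObservable Λ a hexCriticalFugacity (5 / 8)
              s(upFace k m, (((![k - 1, m] : Site 2)), (1 : Fin 2)))‖) := by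
  set F : Sym2 HexVertex → ℂ := hexParafermionicObservable Λ a hexCriticalFugacity (5 / 8)
  set v : HexVertex := upFace k m
  set q : HexVertex := (((![k, m] : Site 2)), (1 : Fin 2)) with hqdef
  set r : HexVertex := (((![k - 1, m] : Site 2)), (1 : Fin 2)) with hrdef
  have hpq : belowFace k m ≠ q := fun h => by
    have h1 := congrArg (fun w : HexVertex => w.1 1) h
    simp [hqdef, belowFace] at h1
  have hqr : q ≠ r := fun h => by
    have h1 := congrArg (fun w : HexVertex => w.1 0) h
    simp [hqdef, hrdef] at h1
    omega
  have hpr : belowFace k m ≠ r := fun h => by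
    have h1 := congrArg (fun w : HexVertex => w.1 0) h
    simp [hrdef, belowFace] at h1
    omega
  -- DCS Lemma 1 at `v` with the neighbours `belowFace k m`, `q`, `r`
  have hVR : (hexMidpoint s(v, belowFace k m) - hexCenter v) * F s(v, belowFace k m) +
      (hexMidpoint s(v, q) - hexCenter v) * F s(v, q) +
      (hexMidpoint s(v, r) - hexCenter v) * F s(v, r) = 0 :=
    DuminilCopinSmirnov2012_lemma1_holds Λ hΛ a ha v hv _ q r (adj_belowFace_upFace k m).symm
      (adj_upFace_right k m) (adj_upFace_left k m) hpq hqr hpr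
  rw [show s(v, belowFace k m) = floorEdge k m from Sym2.eq_swap] at hVR
  have heq : (hexMidpoint (floorEdge k m) - hexCenter v) * F (floorEdge k m) =
      -((hexMidpoint s(v, q) - hexCenter v) * F s(v, q) +
        (hexMidpoint s(v, r) - hexCenter v) * F s(v, r)) := by
    rw [← sub_eq_zero, sub_neg_eq_add, ← hVR]; ring
  have hnorm : ‖hexMidpoint (floorEdge k m) - hexCenter v‖ * ‖F (floorEdge k m)‖ ≤
      1 / 2 * ‖F s(v, q)‖ + 1 / 2 * ‖F s(v, r)‖ := by
    rw [← norm_mul, heq, norm_neg]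
    refine (norm_add_le _ _).trans (add_le_add ?_ ?_) <;> rw [norm_mul]
    · exact mul_le_mul_of_nonneg_right (norm_hexMidpoint_sub_hexCenter_le (adj_upFace_right k m))
        (norm_nonneg _)
    · exact mul_le_mul_of_nonneg_right (norm_hexMidpoint_sub_hexCenter_le (adj_upFace_left k m))
        (norm_nonneg _)
  have h4 : 1 / 4 * ‖F (floorEdge k m)‖ ≤
      ‖hexMidpoint (floorEdge k m) - hexCenter v‖ * ‖F (floorEdge k m)‖ :=
    mul_le_mul_of_nonneg_right (quarter_le_norm_floor_halfEdge k m) (norm_nonneg _)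
  linarith

/-! ### 2. One window: the core of the reduction -/

/-- **Slack of a closed ball inside an open ball.** If `closedBall y ρ₀ ⊆ ball c R` in `ℂ`, then
`closedBall y (ρ₀ + 2ε) ⊆ ball c R` for some `ε ∈ (0, ρ₀/2]` (a compact inside an open set has a
closed thickening inside it). [folklore] -/
theorem exists_slack {y c : ℂ} {ρ₀ R : ℝ} (hρ₀ : 0 < ρ₀)
    (hsub : Metric.closedBall y ρ₀ ⊆ Metric.ball c R) :
    ∃ ε : ℝ, 0 < ε ∧ ε ≤ ρ₀ / 2 ∧ Metric.closedBall y (ρ₀ + 2 * ε) ⊆ Metric.ball c R := by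
  obtain ⟨η, hη, hηsub⟩ :=
    (isCompact_closedBall y ρ₀).exists_cthickening_subset_open Metric.isOpen_ball hsub
  rw [cthickening_closedBall hη.le hρ₀.le] at hηsub
  refine ⟨min (η / 2) (ρ₀ / 2), lt_min (half_pos hη) (half_pos hρ₀), min_le_right _ _, ?_⟩
  refine (Metric.closedBall_subset_closedBall ?_).trans hηsub
  linarith [min_le_left (η / 2) (ρ₀ / 2)]

/-- **The core (one window).** Frame: a region `carrier` which inside `ball c₀ R` is the open
half-plane above `c₀`; a set `S ⊇ {im ≥ im c₀} ∩ ball c₀ R` on whose compacts off the root `x` the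
local sup law holds for the spin-`5/8` observable normalised at `b δ`; eventually `Λ δ` is simply
connected, `b δ`, `e δ` are boundary mid-edges, the faces of `Λ δ` have scaled centres in `carrier`,
and inside `ball c₀ R` membership in `Λ δ` is decided by the row threshold `mrow δ`.  Then on a
window `ball y ρ₀` with `closedBall y ρ₀ ⊆ ball c₀ R`, `x ∉ closedBall y (2ρ₀)` (the stub's
`im y = im c₀` is not needed) the floor-edge arrival masses are `≤ C · Z(b δ)`, eventually (slack,
compact `K = closedBall y (ρ₀+ε) ∩ {im ≥ im c₀}`, pin, vertex relation at the up-face: see the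
module docstring). [cite: DuminilCopinSmirnov2012, Lemma 1] -/
theorem flatDensityUpper_core {Λ : ℝ → Finset HexVertex} {e b : ℝ → Sym2 HexVertex}
    {mrow : ℝ → ℤ} {carrier S : Set ℂ} {c₀ x y : ℂ} {R ρ₀ : ℝ}
    (hcar : carrier ∩ Metric.ball c₀ R = {z : ℂ | c₀.im < z.im} ∩ Metric.ball c₀ R)
    (hS : {z : ℂ | c₀.im ≤ z.im} ∩ Metric.ball c₀ R ⊆ S)
    (hSup : ∀ K : Set ℂ, IsCompact K → K ⊆ S → x ∉ K →
      ∃ C : ℝ, ∀ᶠ δ : ℝ in 𝓝[>] 0, ∀ z ∈ hexDomainMidEdges (Λ δ), (δ : ℂ) * hexMidpoint z ∈ K →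
        ‖hexParafermionicObservable (Λ δ) (e δ) hexCriticalFugacity (5 / 8) z‖ ≤
          C * ‖hexParafermionicObservable (Λ δ) (e δ) hexCriticalFugacity (5 / 8) (b δ)‖)
    (hev : ∀ᶠ δ : ℝ in 𝓝[>] 0, hexDomainSimplyConnected (Λ δ) ∧ b δ ∈ hexDomainBoundary (Λ δ) ∧
      e δ ∈ hexDomainBoundary (Λ δ) ∧ (∀ v ∈ Λ δ, (δ : ℂ) * hexCenter v ∈ carrier) ∧
      (∀ v : HexVertex, (δ : ℂ) * hexCenter v ∈ Metric.ball c₀ R → (v ∈ Λ δ ↔ mrow δ ≤ v.1 1)))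
    (hρ₀ : 0 < ρ₀) (hsub : Metric.closedBall y ρ₀ ⊆ Metric.ball c₀ R)
    (hx : x ∉ Metric.closedBall y (2 * ρ₀)) :
    ∃ C : ℝ, 0 < C ∧ ∀ᶠ δ : ℝ in 𝓝[>] 0, ∀ k : ℤ,
      (δ : ℂ) * hexMidpoint (floorEdge k (mrow δ)) ∈ Metric.ball y ρ₀ →
      ‖hexParafermionicObservable (Λ δ) (e δ) hexCriticalFugacity 0 (floorEdge k (mrow δ))‖ ≤
        C * ‖hexParafermionicObservable (Λ δ) (e δ) hexCriticalFugacity 0 (b δ)‖ := by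
  -- slack, and the compact `K`
  obtain ⟨ε, hε, hε2, hεsub⟩ := exists_slack hρ₀ hsub
  set K : Set ℂ := Metric.closedBall y (ρ₀ + ε) ∩ {z : ℂ | c₀.im ≤ z.im}
  have hKc : IsCompact K :=
    (isCompact_closedBall y (ρ₀ + ε)).inter_right (isClosed_le continuous_const Complex.continuous_im)
  have hballR : Metric.closedBall y (ρ₀ + ε) ⊆ Metric.ball c₀ R :=
    (Metric.closedBall_subset_closedBall (by linarith)).trans hεsub
  have hxK : x ∉ K := fun h => hx (Metric.closedBall_subset_closedBall (by linarith) h.1)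
  obtain ⟨C, hC⟩ := hSup K hKc (fun z hz => hS ⟨hz.2, hballR hz.1⟩) hxK
  refine ⟨4 * max C 0 + 1, by positivity, ?_⟩
  filter_upwards [hC, hev, Ioo_mem_nhdsGT hε] with δ hCδ ⟨hsc, hb, he, hcarr, hpin⟩ ⟨hδ0, hδε⟩ k hk
  set M : ℤ := mrow δ
  set F : Sym2 HexVertex → ℂ := hexParafermionicObservable (Λ δ) (e δ) hexCriticalFugacity (5 / 8)
  set w : ℂ := (δ : ℂ) * hexMidpoint (floorEdge k M) with hw
  have hfe_edge : floorEdge k M ∈ hexGraph.edgeSet :=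
    (SimpleGraph.mem_edgeSet hexGraph).2 (adj_belowFace_upFace k M)
  -- points within `δ` of `w` lie in the closed ball of `K`
  have hnear : ∀ z : ℂ, dist z w ≤ δ → z ∈ Metric.closedBall y (ρ₀ + ε) := fun z hz => by
    rw [Metric.mem_closedBall]
    linarith [dist_triangle z w y, Metric.mem_ball.1 hk]
  have hdv : dist ((δ : ℂ) * hexCenter (upFace k M)) w ≤ δ / 2 :=
    dist_smul_hexCenter_smul_hexMidpoint_le hδ0.le hfe_edge (Sym2.mem_mk_right _ _)
  have hcv_ball : (δ : ℂ) * hexCenter (upFace k M) ∈ Metric.ball c₀ R :=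
    hballR (hnear _ (by linarith))
  have hcp_ball : (δ : ℂ) * hexCenter (belowFace k M) ∈ Metric.ball c₀ R :=
    hballR (hnear _ (by
      linarith [dist_smul_hexCenter_smul_hexMidpoint_le hδ0.le hfe_edge (Sym2.mem_mk_left _ _)]))
  -- pin: the up-face is in `Λ δ`, the floor edge is a boundary mid-edge, `im (δ c_v) > im c₀`
  have hvΛ : upFace k M ∈ Λ δ := (hpin _ hcv_ball).2 (by simp [upFace])
  have hfeB : floorEdge k M ∈ hexDomainBoundary (Λ δ) :=
    floorEdge_mem_boundary_of_pin hpin hcv_ball hcp_ball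
  have hcv_im : c₀.im < ((δ : ℂ) * hexCenter (upFace k M)).im := by
    have h : (δ : ℂ) * hexCenter (upFace k M) ∈ carrier ∩ Metric.ball c₀ R :=
      ⟨hcarr _ hvΛ, hcv_ball⟩
    rw [hcar] at h
    exact h.1
  -- the two upper edges at the up-face have scaled midpoints in `K`: the sup law bounds them
  have hupper : ∀ q : Site 2, q 1 = M → hexGraph.Adj (upFace k M) (q, (1 : Fin 2)) →
      ‖F s(upFace k M, (q, (1 : Fin 2)))‖ ≤ max C 0 * ‖F (b δ)‖ := by
    intro q hq hadj
    have hzE : s(upFace k M, (q, (1 : Fin 2))) ∈ hexGraph.edgeSet :=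
      (SimpleGraph.mem_edgeSet hexGraph).2 hadj
    have hK1 : (δ : ℂ) * hexMidpoint s(upFace k M, (q, (1 : Fin 2))) ∈ K := by
      refine ⟨hnear _ ?_, ?_⟩
      · have h1 := dist_smul_hexCenter_smul_hexMidpoint_le hδ0.le hzE (Sym2.mem_mk_left _ _)
        rw [dist_comm] at h1
        linarith [dist_triangle ((δ : ℂ) * hexMidpoint s(upFace k M, (q, (1 : Fin 2))))
          ((δ : ℂ) * hexCenter (upFace k M)) w]
      · show c₀.im ≤ ((δ : ℂ) * hexMidpoint s(upFace k M, (q, (1 : Fin 2)))).im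
        have him := mul_le_mul_of_nonneg_left
          (im_hexCenter_le_im_hexMidpoint (![k, M]) q (by simp [hq])) hδ0.le
        rw [Complex.im_ofReal_mul] at hcv_im ⊢
        exact (hcv_im.trans_le him).le
    exact (hCδ _ ⟨hzE, upFace k M, Sym2.mem_mk_left _ _, hvΛ⟩ hK1).trans
      (mul_le_mul_of_nonneg_right (le_max_left _ _) (norm_nonneg _))
  -- the vertex relation at the up-face, and the boundary identities `‖F_{5/8}‖ = Z`
  rw [← norm_observable_eq_norm_zero_spin_of_mem_boundary hsc he hfeB _ (5 / 8),
    ← norm_observable_eq_norm_zero_spin_of_mem_boundary hsc he hb _ (5 / 8)]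
  have h0 : 0 ≤ ‖F (b δ)‖ := norm_nonneg _
  calc ‖F (floorEdge k M)‖ ≤ 2 * (‖F s(upFace k M, (((![k, M] : Site 2)), (1 : Fin 2)))‖ +
        ‖F s(upFace k M, (((![k - 1, M] : Site 2)), (1 : Fin 2)))‖) :=
      norm_floorEdge_le_of_vertexRelation hsc he hvΛ
    _ ≤ 2 * (max C 0 * ‖F (b δ)‖ + max C 0 * ‖F (b δ)‖) := by
      gcongr
      · exact hupper (![k, M]) (by simp) (adj_upFace_right k M)
      · exact hupper (![k - 1, M]) (by simp) (adj_upFace_left k M)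
    _ = 4 * max C 0 * ‖F (b δ)‖ := by ring
    _ ≤ (4 * max C 0 + 1) * ‖F (b δ)‖ := by nlinarith

/-! ### 3. The reduction `LocalSupBound → FlatDensityUpper` (registered statement, unfolded) -/

/-- **The upper half of the flat density law from the local sup law** (stub
`stub_flatDensityUpperOfSup` of the line `pick-half-plane`; the statements `LocalSupBound` and
`FlatDensityUpper` of the skeleton with `AdmissibleFamily`, `PinnedFlatRoot`, `flatPoints` unfolded
verbatim).  For an admissible family, a pinned flat root `x ≠ D.pt 1` and a window `ball y ρ₀` on
the gate piece (`im y = im (D.pt 1)`, `closedBall y ρ₀ ⊆ ball (D.pt 1) ρ`, row function `m`) or on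
the root piece (`im y = im x`, `closedBall y ρ₀ ⊆ ball x r`, row function `mr`) with
`x ∉ closedBall y (2ρ₀)`: ONE `C > 0` with, eventually as `δ → 0+`,
`Z(floorEdge k (row δ)) ≤ C · Z(b δ)` for every floor edge whose scaled midpoint lies in
`ball y ρ₀` — `flatDensityUpper_core` in the frame `(carrier, c₀, R) = (D.carrier, D.pt 1, ρ)`,
resp. `(D.carrier, x, r)`, with `S = D.carrier ∪ flatPoints ⊇ {im ≥ im c₀} ∩ ball c₀ R` by the
carrier pin. [cite: DuminilCopinSmirnov2012, Lemma 1] -/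
theorem flatDensityUpper_of_localSupBound :
    (∀ (D : DobrushinDomain) (ρ : ℝ) (Λ : ℝ → Finset HexVertex) (m : ℝ → ℤ)
        (b : ℝ → Sym2 HexVertex),
      (0 < ρ ∧
        D.carrier ∩ Metric.ball (D.pt 1) ρ =
          {z : ℂ | (D.pt 1).im < z.im} ∩ Metric.ball (D.pt 1) ρ ∧
        (∀ᶠ δ : ℝ in 𝓝[>] 0, hexDomainSimplyConnected (Λ δ) ∧ b δ ∈ hexDomainBoundary (Λ δ) ∧
          (hexGraph.induce ((Λ δ : Finset HexVertex) : Set HexVertex)).Preconnected ∧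
          (∀ v ∈ Λ δ, (δ : ℂ) * hexCenter v ∈ D.carrier) ∧
          (∀ v : HexVertex, (δ : ℂ) * hexCenter v ∈ Metric.ball (D.pt 1) ρ →
            (v ∈ Λ δ ↔ m δ ≤ v.1 1))) ∧
        (∀ K : Set ℂ, IsCompact K → K ⊆ D.carrier →
          ∀ᶠ δ : ℝ in 𝓝[>] 0, ∀ v : HexVertex, (δ : ℂ) * hexCenter v ∈ K → v ∈ Λ δ) ∧
        Tendsto (fun δ : ℝ => (δ : ℂ) * hexMidpoint (b δ)) (𝓝[>] 0) (𝓝 (D.pt 1))) →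
      ∀ (x : ℂ) (e : ℝ → Sym2 HexVertex) (r : ℝ) (mr : ℝ → ℤ),
      (0 < r ∧
        D.carrier ∩ Metric.ball x r = {z : ℂ | x.im < z.im} ∩ Metric.ball x r ∧
        (∀ᶠ δ : ℝ in 𝓝[>] 0, e δ ∈ hexDomainBoundary (Λ δ) ∧
          Nonempty (HexMidEdgeSAW (Λ δ) (e δ) (b δ)) ∧
          (∀ v : HexVertex, (δ : ℂ) * hexCenter v ∈ Metric.ball x r →
            (v ∈ Λ δ ↔ mr δ ≤ v.1 1))) ∧
        Tendsto (fun δ : ℝ => (δ : ℂ) * hexMidpoint (e δ)) (𝓝[>] 0) (𝓝 x)) →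
      x ≠ D.pt 1 →
      ∀ K : Set ℂ, IsCompact K →
        K ⊆ D.carrier ∪
          (({z : ℂ | z.im = (D.pt 1).im} ∩ Metric.ball (D.pt 1) ρ) ∪
            ({z : ℂ | z.im = x.im} ∩ Metric.ball x r)) →
        x ∉ K →
        ∃ C : ℝ, ∀ᶠ δ : ℝ in 𝓝[>] 0, ∀ z ∈ hexDomainMidEdges (Λ δ),
          (δ : ℂ) * hexMidpoint z ∈ K →
          ‖hexParafermionicObservable (Λ δ) (e δ) hexCriticalFugacity (5 / 8) z‖ ≤
            C * ‖hexParafermionicObservable (Λ δ) (e δ) hexCriticalFugacity (5 / 8) (b δ)‖) →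
    ∀ (D : DobrushinDomain) (ρ : ℝ) (Λ : ℝ → Finset HexVertex) (m : ℝ → ℤ)
        (b : ℝ → Sym2 HexVertex),
      (0 < ρ ∧
        D.carrier ∩ Metric.ball (D.pt 1) ρ =
          {z : ℂ | (D.pt 1).im < z.im} ∩ Metric.ball (D.pt 1) ρ ∧
        (∀ᶠ δ : ℝ in 𝓝[>] 0, hexDomainSimplyConnected (Λ δ) ∧ b δ ∈ hexDomainBoundary (Λ δ) ∧
          (hexGraph.induce ((Λ δ : Finset HexVertex) : Set HexVertex)).Preconnected ∧
          (∀ v ∈ Λ δ, (δ : ℂ) * hexCenter v ∈ D.carrier) ∧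
          (∀ v : HexVertex, (δ : ℂ) * hexCenter v ∈ Metric.ball (D.pt 1) ρ →
            (v ∈ Λ δ ↔ m δ ≤ v.1 1))) ∧
        (∀ K : Set ℂ, IsCompact K → K ⊆ D.carrier →
          ∀ᶠ δ : ℝ in 𝓝[>] 0, ∀ v : HexVertex, (δ : ℂ) * hexCenter v ∈ K → v ∈ Λ δ) ∧
        Tendsto (fun δ : ℝ => (δ : ℂ) * hexMidpoint (b δ)) (𝓝[>] 0) (𝓝 (D.pt 1))) →
      ∀ (x : ℂ) (e : ℝ → Sym2 HexVertex) (r : ℝ) (mr : ℝ → ℤ),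
      (0 < r ∧
        D.carrier ∩ Metric.ball x r = {z : ℂ | x.im < z.im} ∩ Metric.ball x r ∧
        (∀ᶠ δ : ℝ in 𝓝[>] 0, e δ ∈ hexDomainBoundary (Λ δ) ∧
          Nonempty (HexMidEdgeSAW (Λ δ) (e δ) (b δ)) ∧
          (∀ v : HexVertex, (δ : ℂ) * hexCenter v ∈ Metric.ball x r →
            (v ∈ Λ δ ↔ mr δ ≤ v.1 1))) ∧
        Tendsto (fun δ : ℝ => (δ : ℂ) * hexMidpoint (e δ)) (𝓝[>] 0) (𝓝 x)) →
      x ≠ D.pt 1 →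
      ∀ (y : ℂ) (ρ₀ : ℝ), 0 < ρ₀ → x ∉ Metric.closedBall y (2 * ρ₀) →
        (y.im = (D.pt 1).im → Metric.closedBall y ρ₀ ⊆ Metric.ball (D.pt 1) ρ →
          ∃ C : ℝ, 0 < C ∧ ∀ᶠ δ : ℝ in 𝓝[>] 0, ∀ k : ℤ,
            (δ : ℂ) * hexMidpoint s((((![k, m δ - 1] : Site 2)), (1 : Fin 2)),
              ((![k, m δ] : Site 2), (0 : Fin 2))) ∈ Metric.ball y ρ₀ →
            ‖hexParafermionicObservable (Λ δ) (e δ) hexCriticalFugacity 0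
                s((((![k, m δ - 1] : Site 2)), (1 : Fin 2)), ((![k, m δ] : Site 2), (0 : Fin 2)))‖ ≤
              C * ‖hexParafermionicObservable (Λ δ) (e δ) hexCriticalFugacity 0 (b δ)‖) ∧
        (y.im = x.im → Metric.closedBall y ρ₀ ⊆ Metric.ball x r →
          ∃ C : ℝ, 0 < C ∧ ∀ᶠ δ : ℝ in 𝓝[>] 0, ∀ k : ℤ,
            (δ : ℂ) * hexMidpoint s((((![k, mr δ - 1] : Site 2)), (1 : Fin 2)),
              ((![k, mr δ] : Site 2), (0 : Fin 2))) ∈ Metric.ball y ρ₀ →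
            ‖hexParafermionicObservable (Λ δ) (e δ) hexCriticalFugacity 0
                s((((![k, mr δ - 1] : Site 2)), (1 : Fin 2)), ((![k, mr δ] : Site 2), (0 : Fin 2)))‖ ≤
              C * ‖hexParafermionicObservable (Λ δ) (e δ) hexCriticalFugacity 0 (b δ)‖) := by
  intro hSup D ρ Λ m b hAF x e r mr hPR hx y ρ₀ hρ₀ hxy
  have hSup' := hSup D ρ Λ m b hAF x e r mr hPR hx
  -- `{im ≥ im c₀} ∩ ball c₀ R ⊆ carrier ∪ flat pieces` in either frame (carrier pin)
  have hS : ∀ (c₀ : ℂ) (R : ℝ),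
      D.carrier ∩ Metric.ball c₀ R = {z : ℂ | c₀.im < z.im} ∩ Metric.ball c₀ R →
      {z : ℂ | z.im = c₀.im} ∩ Metric.ball c₀ R ⊆
        (({z : ℂ | z.im = (D.pt 1).im} ∩ Metric.ball (D.pt 1) ρ) ∪
          ({z : ℂ | z.im = x.im} ∩ Metric.ball x r)) →
      {z : ℂ | c₀.im ≤ z.im} ∩ Metric.ball c₀ R ⊆ D.carrier ∪
        (({z : ℂ | z.im = (D.pt 1).im} ∩ Metric.ball (D.pt 1) ρ) ∪
          ({z : ℂ | z.im = x.im} ∩ Metric.ball x r)) := by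
    rintro c₀ R hcar hflat z ⟨hzim, hzb⟩
    rcases (show c₀.im ≤ z.im from hzim).lt_or_eq with hlt | heq
    · have hz : z ∈ D.carrier ∩ Metric.ball c₀ R := by rw [hcar]; exact ⟨hlt, hzb⟩
      exact Or.inl hz.1
    · exact Or.inr (hflat ⟨heq.symm, hzb⟩)
  have hev : ∀ᶠ δ : ℝ in 𝓝[>] 0, hexDomainSimplyConnected (Λ δ) ∧
      b δ ∈ hexDomainBoundary (Λ δ) ∧ e δ ∈ hexDomainBoundary (Λ δ) ∧
      (∀ v ∈ Λ δ, (δ : ℂ) * hexCenter v ∈ D.carrier) ∧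
      ((∀ v : HexVertex, (δ : ℂ) * hexCenter v ∈ Metric.ball (D.pt 1) ρ →
          (v ∈ Λ δ ↔ m δ ≤ v.1 1)) ∧
        (∀ v : HexVertex, (δ : ℂ) * hexCenter v ∈ Metric.ball x r → (v ∈ Λ δ ↔ mr δ ≤ v.1 1))) := by
    filter_upwards [hAF.2.2.1, hPR.2.2.1] with δ h1 h2
    exact ⟨h1.1, h1.2.1, h2.1, h1.2.2.2.1, h1.2.2.2.2, h2.2.2⟩
  refine ⟨fun _ hsub => ?_, fun _ hsub => ?_⟩
  · -- the gate piece: frame `(D.carrier, D.pt 1, ρ)`, row function `m`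
    exact flatDensityUpper_core hAF.2.1 (hS _ _ hAF.2.1 fun z hz => Or.inl hz) hSup'
      (hev.mono fun δ h => ⟨h.1, h.2.1, h.2.2.1, h.2.2.2.1, h.2.2.2.2.1⟩) hρ₀ hsub hxy
  · -- the root piece: frame `(D.carrier, x, r)`, row function `mr`
    exact flatDensityUpper_core hPR.2.1 (hS _ _ hPR.2.1 fun z hz => Or.inr hz) hSup'
      (hev.mono fun δ h => ⟨h.1, h.2.1, h.2.2.1, h.2.2.2.1, h.2.2.2.2.2⟩) hρ₀ hsub hxy

end Summit.CriticalPhenomena.SAWScalingLimit.Theorems.PickHalfPlane.FlatDensityUpper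

end
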